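import Literature.MathematicalPhysics.QuantumFieldTheory.Balaban1983to89.B6KLevelCensusIndexV1
import Literature.MathematicalPhysics.QuantumFieldTheory.Balaban1983to89.B6Prop26LapKLevelV1
import Literature.MathematicalPhysics.QuantumFieldTheory.Balaban1983to89.B6KLevelFamilyWitnessV1
import HarnessLib

/-!
# `Balaban1983to89.B6Prop26Census2136KLevelV1` — T. Bałaban, *Propagators and renormalization transformations for lattice gauge theories. II*,
Comm. Math. Phys. **96** (1984) 223–250 [Balaban1984PropagatorsII], p. 247 **PROPOSITION 2.6: THE CENSUS READINGS `GFamily` OF THE GENUINE k-LEVEL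
`G = Δ_a⁻¹` AND THE FOUR SUP ENTRIES (2.136) OF THE VERBATIM CENSUS TYPING `…B6.Prop26Printed` — ITS FIRST CONJUNCT — ON THE GENUINE k-LEVEL V1
FAMILY, MODULO ONE DISPLAYED INPUT** (the third entry `|(G∇*J)(x)|`, p38's `B6Prop26DivLegKLevelV1` programme, in flight), for every number of
levels `k ≥ 2` (B6-CLOSURE §5 item 21, first file; fold owner r03).

HONEST FRAMING (programme rule): statement-level skeleton of published theorems with citation tags; proofs where landed; nothing here
is a claim about the Yang–Mills mass gap.

PRINT (verbatim, p. 247 [PDF 25]): «Proposition 2.6. There exists a positive constant δ₃ depending on d and L only, such that |(GJ)(x)|, |(∇GJ)(x)|,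
|(G∇*J)(x)|, |(ΔGJ)(x)| ≤ O(1)[(L^jη)², L^jη, L^jη, 1]e^{−δ₃d(y,y′)}|J| (2.136) for x ∈ Δ(y), y ∈ Λ_j, supp J ⊂ Δ(y′), with the constant O(1)
depending on d and L only; ‖ζ∇GJ‖_α, ‖ζG∇*J‖_α ≤ O(1)(L^jη)^{1−α}(‖ζ‖^ξ_α + |ζ|)e^{−δ₃d(y,y′)}|J|, ξ = L^{−j} (2.137) …; |(∇G∇*J)(x)| ≤
O(1)e^{−δ₃d(y,y′)}(‖J‖^{ξ′}_ε + |J|) (2.138) …; ‖ζ∇G∇*J‖_α ≤ O(1)(L^jη)^{−α}(‖ζ‖^ξ_α + |ζ|)e^{−δ₃d(y,y′)}(‖J‖^{ξ′}_{α+ε} + |J|) (2.139) …;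
‖ζGJ‖, ‖ζ∇GJ‖, ‖ζG∇*J‖, ‖ζ∇G∇*J‖, ‖ζ∇∇GJ‖, ‖ζG∇*∇*J‖ ≤ O(1)[(L^jη)², L^jη, L^jη, 1, 1, 1]|ζ|e^{−δ₃d(y,y′)}‖J‖ (2.140) if supp ζ ⊂ Δ(y), y ∈ Λ_j,
supp J ⊂ Δ(y′), with the constant O(1) depending on d and L.»

## WHAT THIS FILE CERTIFIES (kernel-checked, sorry-free, standard axioms)

* §1 THE READINGS of the census slots `B6.GFamily` for the genuine `G = onFun (GE (domT hN D hk))` of an index `i : KIdx` on the block-site geometry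
  `kGeoG i` of `B6KLevelCensusIndexV1`: `supIn i y f` = sup over the fine bonds `x ∈ Δ(y)` of `|f(x)|`; `holderQ i α ζ f` = sup over admissible ordered
  pairs of `|x − x′|_phys^{−α}|ζ(x)f(x) − ζ(x′)f(x′)|` (`|x − x′|_phys = |x − x′|_∞·η`); `l2Of h f = (Σ_x (h(x)f(x))²)^{1/2}`; **`kG i : B6.GFamily (kGeoG i)`**
  with `e 0..3` = `supIn` of `GJ`, `∇_νGJ` (sup over `ν`), `G∇_ν*J` (sup over `ν`), `ΔGJ` ((2.136); `∇_ν = DV ν c_f`, `∇*_ν = DVa ν c_f`,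
  `Δ = LapV c_f = Σ_ν∇*_ν∇_ν` of `B6GradLegKLevelV1`/`B6LapLegKLevelV1`), `h1` = max of the `holderQ` of `∇_νGJ` and of `G∇*_νJ` ((2.137)),
  `e4` = `supIn` of `∇_νG∇*_μJ` ((2.138)), `h2` = `holderQ` of `∇_νG∇*_μJ` ((2.139)), `l2 0..5` = `l2Of h` of `GJ`, `∇_νGJ`, `G∇*_νJ`, `∇_νG∇*_μJ`,
  `∇_ν∇_μGJ`, `G∇*_ν∇*_μJ` ((2.140)) — the TARGET READINGS for every k-level slot file (sups over directions where print has a vector index);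
* §2 **`prop26_census2136_kLevel_of_div`** — THE FIRST CONJUNCT OF `B6.Ineq2136_2140` (all four entries of (2.136)) UNIFORMLY ON THE FAMILY:
  `∃ M₁ δ₃ C > 0, ∀ i, M₁ ≤ M → ∀ n J y y′, supp J ⊂ Δ(y′) → (kG i).e n J y ≤ C·[(Lʲη)², Lʲη, Lʲη, 1]_n·e^{−δ₃ d(y,y′)}·|J|`, the entries `0, 1, 3` fed BY
  NAME by p38's `B6Prop26LapKLevelV1.prop26_2136_lap_kLevel_unconditional` ((2.136)₁,₂,₄ at k levels for the genuine `G`, no displayed analytic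
  hypothesis; `σ := σ₁`, rate exponent `½`) and the entry `2` by ONE DISPLAYED INPUT `h3` = the k-level (2.136)₃ majorant of `G∇*_ν` in the shape of
  the other entries (`∃ δ A M₂ N₁ …, HasMajorant (onFun G ∘ₗ DVa ν c_f) (A·(len y·|c_f|⁻¹)·e^{−δ d_T})` — p38's `B6Prop26DivLegKLevelV1.prop26_2136_div_kLevel`
  re-packaged, in flight); witnesses `M₁ = max (max M₂ M₂′) (N₁ + 1)` (ONE printed threshold covers both files' thresholds since `R ≥ 1`),
  `δ₃ = min (delta3 ½ (2σ₁)) δ`, `C = max (max A A′) 1`; `supp J ⊂ Δ(y′)` enters through `B6KLevelCensusIndexV1.blockSupp_of_suppIn`;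
* §3 `kLevelG_meets_hypotheses`: NON-VACUITY at `L = 5` (`B6KLevelFamilyWitnessV1.kLevelFamily_nonvacuous_L5`).

## HONEST SCOPE

(1) (2.136) ONLY (the first of the five conjuncts of `B6.Prop26Printed`), and its third entry MODULO the displayed `h3`; (2.137)–(2.140) on this family are
the remaining slots (`h1`: p22 `B6Ineq2137GradKLevelV1` + p38; `e4`, `h2`, `l2 3..5`: unowned at the time of writing; `l2 0..2`: p22), whose census
readings are FIXED here.  (2) Constants `C`, `δ₃` depend on `d, L` AND the band `b₀, b₁` (print: on `d, L`).  (3) Readings as documented in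
`B6KLevelCensusIndexV1` (`dist` = p21's torus graph distance of blocks, `η = |c_f|⁻¹`, flat `ℓ²` entries of the genuine operators).  DEFINITIONS (data) +
THEOREMS; no `def … : Prop` fact; the displayed input is a hypothesis binder, not a declaration.  NOT summit progress.  Unit `lit-balaban-r03` (gen 26),
2026-08-24.
-/

noncomputable section

namespace Literature.MathematicalPhysics.QuantumFieldTheory.Balaban1983to89.B6Prop26Census2136KLevelV1

open LatticeFieldCalculus
open B6SectAOperatorsV1 (BondIdx)
open B6SectAVectorModelV1 (GE)
open B6Ineq2133TwoScaleV1 (onFun)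
open B6RandomWalk (HasMajorant BlockSupp delta3 delta3_pos)
open B6MultiLevelBoxOperator (N0)
open B6MultiLevelTorusOperator (TDomains)
open B6GlobalChartV1 (PV domT blkV1)
open B6Geom246MultiLevelTorus (geomT)
open B6Prop26KLevelSkeletonV1 (pref)
open B6Prop26KLevelAssemblyV1 (distT_nonneg)
open B6CubeWindowV1 (Placed GlobalBand)
open B6Cover236MultiLevelBlocks (cubes)
open B6GradLegKLevelV1 (DV)
open B6LapLegKLevelV1 (DVa LapV)
open B6Prop26LapKLevelV1 (prop26_2136_lap_kLevel_unconditional)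
open B6KLevelCensusIndexV1 (KIdx Adm kGeoG lenG_eq lenG_pos lenG_eq_geomT abs_le_supNormG supNormG_nonneg blockSupp_of_suppIn)

variable {d ℓ : ℕ} {hd : 1 ≤ d + 1} {hL : Odd (ℓ + 1) ∧ 1 < ℓ + 1} {b₀ b₁ : ℝ}

/-! ## §1  The census readings of the genuine k-level `G` -/

/-- **the genuine `G = Δ_a⁻¹` of the index as an operator on fine-bond functions** (`onFun (GE (domT hN D hk))`, the operator of every k-level (2.136) file).
[cite: Balaban1984PropagatorsII, (2.129)–(2.130) p.246, (2.136) p.247] -/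
abbrev Gop (i : KIdx d ℓ hd hL b₀ b₁) : Module.End ℝ (PBond (PV d ℓ i.m i.K hd hL) 0 → ℝ) :=
  onFun (GE (domT i.hN i.D i.hk) i.hcf i.hw)

/-- **`sup_{x ∈ Δ(y)} |f(x)|`** — the supremum of `|f|` over the fine bonds of the block `y` (`0` if there are none).
[cite: Balaban1984PropagatorsII, (2.136) p.247 («for x ∈ Δ(y)»)] -/
def supIn (i : KIdx d ℓ hd hL b₀ b₁) (y : (geomT i.D).Site) (f : PBond (PV d ℓ i.m i.K hd hL) 0 → ℝ) : ℝ :=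
  ⨆ x : {x : PBond (PV d ℓ i.m i.K hd hL) 0 // blkV1 i.hN i.D x = y}, |f x.1|

/-- bounding `sup_{x ∈ Δ(y)} |f(x)|` by a nonnegative blockwise bound. [cite: Balaban1984PropagatorsII, (2.136) p.247, bookkeeping] -/
theorem supIn_le (i : KIdx d ℓ hd hL b₀ b₁) {y : (geomT i.D).Site} {f : PBond (PV d ℓ i.m i.K hd hL) 0 → ℝ} {a : ℝ} (ha : 0 ≤ a)
    (h : ∀ x, blkV1 i.hN i.D x = y → |f x| ≤ a) : supIn i y f ≤ a :=
  Real.iSup_le (fun x => h x.1 x.2) ha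

open Classical in
/-- **the Hölder quotient of `ζ·f` over the admissible ordered pairs**: `sup |x − x′|_phys^{−α}|ζ(x)f(x) − ζ(x′)f(x′)|`, `|x − x′|_phys = |x − x′|_∞·η`
(print's `‖ζf‖_α` of (2.137)/(2.139), [4] (1.109), quotient at the scale of the block of the first point).
[cite: Balaban1984PropagatorsII, (2.137) p.247; Balaban1984PropagatorsI, (1.109) p.35] -/
def holderQ (i : KIdx d ℓ hd hL b₀ b₁) (α : ℝ) (ζ f : PBond (PV d ℓ i.m i.K hd hL) 0 → ℝ) : ℝ :=
  ⨆ q : PBond (PV d ℓ i.m i.K hd hL) 0 × PBond (PV d ℓ i.m i.K hd hL) 0,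
    if Adm i q.1 q.2 then ((((supDist q.1.src q.2.src : ℕ) : ℝ)) * |i.cf|⁻¹) ^ (-α) * |ζ q.1 * f q.1 - ζ q.2 * f q.2| else 0

/-- **the flat `L²` norm of `h·f`**: `(Σ_x (h(x)f(x))²)^{1/2}` (print's `‖ζ·‖` of (2.140); the `η^d`-weights of (2.69) cancel between the two sides).
[cite: Balaban1984PropagatorsII, (2.140) p.247, (2.69) p.235] -/
def l2Of {X : Type*} [Fintype X] (h f : X → ℝ) : ℝ := Real.sqrt (∑ x, (h x * f x) ^ 2)

/-- **THE CENSUS READINGS `GFamily` OF THE GENUINE k-LEVEL `G`** on `kGeoG i`: `e 0..3` = sup over `x ∈ Δ(y)` (and over the direction) of `|(GJ)(x)|`,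
`|(∇_νGJ)(x)|`, `|(G∇*_νJ)(x)|`, `|(ΔGJ)(x)|` ((2.136)); `h1 J α ζ` = the larger of the Hölder quotients of `ζ∇_νGJ` and `ζG∇*_νJ` ((2.137)); `e4` = sup of
`|(∇_νG∇*_μJ)(x)|` ((2.138)); `h2` = Hölder quotient of `ζ∇_νG∇*_μJ` ((2.139)); `l2 0..5` = `‖hGJ‖, ‖h∇_νGJ‖, ‖hG∇*_νJ‖, ‖h∇_νG∇*_μJ‖, ‖h∇_ν∇_μGJ‖,
‖hG∇*_ν∇*_μJ‖` ((2.140)), with `∇_ν = DV ν c_f`, `∇*_ν = DVa ν c_f`, `Δ = LapV c_f`. [cite: Balaban1984PropagatorsII, Prop. 2.6 (2.136)–(2.140) p.247] -/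
def kG (i : KIdx d ℓ hd hL b₀ b₁) : B6.GFamily (kGeoG i) where
  e := fun n J y =>
    (![supIn i y (Gop i J),
       ⨆ ν : Fin (d + 1), supIn i y ((DV ν i.cf ∘ₗ Gop i) J),
       ⨆ ν : Fin (d + 1), supIn i y ((Gop i ∘ₗ DVa ν i.cf) J),
       supIn i y ((LapV i.cf ∘ₗ Gop i) J)] : Fin 4 → ℝ) n
  h1 := fun J α ζ =>
    max (⨆ ν : Fin (d + 1), holderQ i α ζ ((DV ν i.cf ∘ₗ Gop i) J)) (⨆ ν : Fin (d + 1), holderQ i α ζ ((Gop i ∘ₗ DVa ν i.cf) J))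
  e4 := fun J y => ⨆ ν : Fin (d + 1), ⨆ μ : Fin (d + 1), supIn i y ((DV ν i.cf ∘ₗ Gop i ∘ₗ DVa μ i.cf) J)
  h2 := fun J α ζ => ⨆ ν : Fin (d + 1), ⨆ μ : Fin (d + 1), holderQ i α ζ ((DV ν i.cf ∘ₗ Gop i ∘ₗ DVa μ i.cf) J)
  l2 := fun n J h =>
    (![l2Of h (Gop i J),
       ⨆ ν : Fin (d + 1), l2Of h ((DV ν i.cf ∘ₗ Gop i) J),
       ⨆ ν : Fin (d + 1), l2Of h ((Gop i ∘ₗ DVa ν i.cf) J),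
       ⨆ ν : Fin (d + 1), ⨆ μ : Fin (d + 1), l2Of h ((DV ν i.cf ∘ₗ Gop i ∘ₗ DVa μ i.cf) J),
       ⨆ ν : Fin (d + 1), ⨆ μ : Fin (d + 1), l2Of h ((DV ν i.cf ∘ₗ DV μ i.cf ∘ₗ Gop i) J),
       ⨆ ν : Fin (d + 1), ⨆ μ : Fin (d + 1), l2Of h ((Gop i ∘ₗ DVa ν i.cf ∘ₗ DVa μ i.cf) J)] : Fin 6 → ℝ) n

/-- `pref c_f y = ((L^{scale}η)(y))²` — the slot-0 prefactor of the k-level (2.136) files is the census `(Lʲη)²`.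
[cite: Balaban1984PropagatorsII, (2.136) p.247, dictionary] -/
theorem pref_eq_lenG_sq (i : KIdx d ℓ hd hL b₀ b₁) (y : (geomT i.D).Site) : pref i.cf y = (kGeoG i).len y ^ 2 := by
  unfold pref
  rw [lenG_eq, div_pow, div_pow, sq_abs]

/-! ## §2  The four sup entries (2.136) of the census, uniformly on the family -/

/-- **[B6] PROPOSITION 2.6 (2.136), THE FIRST CONJUNCT OF `B6.Prop26Printed`'s `Ineq2136_2140`, ON THE GENUINE k-LEVEL V1 FAMILY** — all four sup
entries `|(GJ)(x)|, |(∇GJ)(x)|, |(G∇*J)(x)|, |(ΔGJ)(x)| ≤ O(1)[(Lʲη)², Lʲη, Lʲη, 1]e^{−δ₃d(y,y′)}|J|` for `x ∈ Δ(y)`, `supp J ⊂ Δ(y′)`, with ONE threshold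
`M₁ ≤ M`, ONE rate `δ₃ > 0` and ONE constant for the whole family: entries (2.136)₁,₂,₄ by p38's `B6Prop26LapKLevelV1.prop26_2136_lap_kLevel_unconditional`
BY NAME (`σ := σ₁`, rate exponent `½`), entry (2.136)₃ by the displayed input `h3` (the k-level majorant of `G∇*_ν`, p38's `B6Prop26DivLegKLevelV1`
programme in the shape of the other entries). [cite: Balaban1984PropagatorsII, Prop. 2.6 (2.136) p.247, (2.141) p.247, Lemma 2.1 p.234] -/
theorem prop26_census2136_kLevel_of_div (hb₀ : 0 < b₀) (hb₁ : b₀ ≤ b₁)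
    (h3 : ∃ (δ A M₂ : ℝ) (N₁ : ℕ), 0 < δ ∧ 0 ≤ A ∧ 0 < M₂ ∧
      ∀ (m K : ℕ) {Mh k R : ℕ} {P' : Fin (d + 1) → ℕ}
        (hN : ∀ μ, N0 ℓ Mh k P' μ = (PV d ℓ m K hd hL).sitesPerDir 0) (D : TDomains d ℓ Mh k P' R) (hk : k ≤ m + K) (_ : 2 ≤ k)
        {a : ℕ} (_ : Mh = (ℓ + 1) ^ a) (_ : 8 ≤ Mh) (_ : 2 * (ℓ + 1) ^ 2 ≤ R) (_ : ∀ μ, 5 ≤ P' μ) (_ : 4 ≤ ℓ)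
        (_ : ∀ c : ↥(cubes D.toDomains), Placed ℓ k P' c.1) (_ : M₂ ≤ ((ℓ : ℝ) + 1) * Mh) (_ : N₁ + 1 ≤ R * ((ℓ + 1) * Mh))
        {cf : ℝ} (hcf : cf ≠ 0) {w : BondIdx (domT hN D hk) → ℝ} (hw : ∀ i, 0 < w i) (_ : GlobalBand b₀ b₁ cf w) (ν : Fin (d + 1)),
        HasMajorant (g := geomT D) (blkV1 hN D) (onFun (GE (domT hN D hk) hcf hw) ∘ₗ DVa ν cf)
          (fun y y' => A * ((geomT D).len y * |cf|⁻¹) * Real.exp (-(δ * (geomT D).dist y y')))) :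
    ∃ M₁ δ₃ C : ℝ, 0 < M₁ ∧ 0 < δ₃ ∧ 0 < C ∧ ∀ i : KIdx d ℓ hd hL b₀ b₁, M₁ ≤ (kGeoG i).M →
      ∀ (n : Fin 4) (J : (kGeoG i).Loc) (y y' : (kGeoG i).Site), (kGeoG i).suppIn J y' →
        (kG i).e n J y ≤ C * B6.pref4 ((kGeoG i).len y) n * Real.exp (-(δ₃ * (kGeoG i).dist y y')) * (kGeoG i).supNorm J := by
  obtain ⟨σ₁, hσ₁, hF⟩ := prop26_2136_lap_kLevel_unconditional d ℓ hd hL hb₀ hb₁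
  obtain ⟨A, M₂, hA, hM₂, hF2⟩ := hF σ₁ hσ₁ le_rfl (1 / 2) (by norm_num) (by norm_num)
  clear hF
  obtain ⟨δ, A', M₂', N₁, hδ, hA', hM₂', h3'⟩ := h3
  have hδ₀ : 0 < delta3 (1 / 2) (2 * σ₁) := delta3_pos (by norm_num) (by linarith)
  set δ₃ : ℝ := min (delta3 (1 / 2) (2 * σ₁)) δ with hδ₃_def
  have hδ₃ : 0 < δ₃ := lt_min hδ₀ hδ
  set C : ℝ := max (max A A') 1 with hC_def
  have hC1 : 1 ≤ C := le_max_right _ _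
  have hC0 : 0 ≤ C := zero_le_one.trans hC1
  have hAC : A ≤ C := (le_max_left _ _).trans (le_max_left _ _)
  have hA'C : A' ≤ C := (le_max_right _ _).trans (le_max_left _ _)
  refine ⟨max (max M₂ M₂') ((N₁ : ℝ) + 1), δ₃, C, lt_max_of_lt_left (lt_max_of_lt_left hM₂), hδ₃, zero_lt_one.trans_le hC1,
    fun i hM n J y y' hJ => ?_⟩
  -- the two files' thresholds from the one printed threshold `M₁ ≤ M = L·M_h`
  have hM' : max (max M₂ M₂') ((N₁ : ℝ) + 1) ≤ (((ℓ + 1 : ℕ) : ℝ)) * (i.Mh : ℝ) := hM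
  have hcast : (((ℓ + 1 : ℕ) : ℝ)) = (ℓ : ℝ) + 1 := by push_cast; ring
  have hM2 : M₂ ≤ ((ℓ : ℝ) + 1) * i.Mh := by rw [← hcast]; exact ((le_max_left _ _).trans (le_max_left _ _)).trans hM'
  have hM2' : M₂' ≤ ((ℓ : ℝ) + 1) * i.Mh := by rw [← hcast]; exact ((le_max_right _ _).trans (le_max_left _ _)).trans hM'
  have hR1 : 1 ≤ i.R :=
    le_trans (Nat.one_le_two_pow) (le_trans (Nat.pow_le_pow_left (by omega : 2 ≤ ℓ + 1) 2 |>.trans (Nat.le_mul_of_pos_left _ (by norm_num))) i.hR2)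
  have hRM : N₁ + 1 ≤ i.R * ((ℓ + 1) * i.Mh) := by
    have h1 : ((N₁ : ℝ) + 1) ≤ (((ℓ + 1 : ℕ) : ℝ)) * (i.Mh : ℝ) := (le_max_right _ _).trans hM'
    have h2 : N₁ + 1 ≤ (ℓ + 1) * i.Mh := by exact_mod_cast h1
    exact h2.trans (Nat.le_mul_of_pos_left _ hR1)
  obtain ⟨h0, h1, hLap⟩ := hF2 i.m i.K i.hN i.D i.hk i.hk2 i.hMha i.hM8 i.hR2 i.hP5 i.hℓ i.hpl hM2 i.hcf i.hw i.hwb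
  have h2 := fun ν => h3' i.m i.K i.hN i.D i.hk i.hk2 i.hMha i.hM8 i.hR2 i.hP5 i.hℓ i.hpl hM2' hRM i.hcf i.hw i.hwb ν
  clear hF2 h3'
  -- the input `J`: «supp J ⊂ Δ(y′)», `|J| = B`
  have hBS := blockSupp_of_suppIn i hJ
  set B : ℝ := (kGeoG i).supNorm J with hB_def
  have hB : 0 ≤ B := supNormG_nonneg i J
  -- common comparisons
  have hlen : 0 < (kGeoG i).len y := lenG_pos i y
  have hd0 : 0 ≤ (geomT i.D).dist y y' := distT_nonneg y y'
  have hexp1 : Real.exp (-(delta3 (1 / 2) (2 * σ₁) * (geomT i.D).dist y y')) ≤ Real.exp (-(δ₃ * (geomT i.D).dist y y')) :=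
    Real.exp_le_exp.2 (neg_le_neg (mul_le_mul_of_nonneg_right (min_le_left _ _) hd0))
  have hexp2 : Real.exp (-(δ * (geomT i.D).dist y y')) ≤ Real.exp (-(δ₃ * (geomT i.D).dist y y')) :=
    Real.exp_le_exp.2 (neg_le_neg (mul_le_mul_of_nonneg_right (min_le_right _ _) hd0))
  have hE0 : 0 ≤ Real.exp (-(δ₃ * (geomT i.D).dist y y')) := (Real.exp_pos _).le
  have hlen1 : (geomT i.D).len y * |i.cf|⁻¹ = (kGeoG i).len y := (lenG_eq_geomT i y).symm
  -- the printed prefactors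
  have hp0 : B6.pref4 ((kGeoG i).len y) 0 = (kGeoG i).len y ^ 2 := rfl
  have hp1 : B6.pref4 ((kGeoG i).len y) 1 = (kGeoG i).len y := rfl
  have hp2 : B6.pref4 ((kGeoG i).len y) 2 = (kGeoG i).len y := rfl
  have hp3 : B6.pref4 ((kGeoG i).len y) 3 = 1 := rfl
  fin_cases n
  · -- (2.136)₁  |(GJ)(x)| ≤ C·(Lʲη)²·e^{−δ₃d}·|J|
    show supIn i y (Gop i J) ≤ C * B6.pref4 ((kGeoG i).len y) 0 * Real.exp (-(δ₃ * (geomT i.D).dist y y')) * B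
    rw [hp0]
    refine supIn_le i (by positivity) fun x hx => ?_
    have h : |Gop i J x| ≤ A * pref i.cf y * Real.exp (-(delta3 (1 / 2) (2 * σ₁) * (geomT i.D).dist y y')) * B := by
      have h' := h0 y' J B hBS x; rw [hx] at h'; exact h'
    rw [pref_eq_lenG_sq] at h
    calc |Gop i J x| ≤ A * (kGeoG i).len y ^ 2 * Real.exp (-(delta3 (1 / 2) (2 * σ₁) * (geomT i.D).dist y y')) * B := h
      _ ≤ C * (kGeoG i).len y ^ 2 * Real.exp (-(δ₃ * (geomT i.D).dist y y')) * B := by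
        gcongr
  · -- (2.136)₂  |(∇_νGJ)(x)| ≤ C·(Lʲη)·e^{−δ₃d}·|J|
    show (⨆ ν : Fin (d + 1), supIn i y ((DV ν i.cf ∘ₗ Gop i) J)) ≤
      C * B6.pref4 ((kGeoG i).len y) 1 * Real.exp (-(δ₃ * (geomT i.D).dist y y')) * B
    rw [hp1]
    refine Real.iSup_le (fun ν => supIn_le i (by positivity) fun x hx => ?_) (by positivity)
    have h : |(DV ν i.cf ∘ₗ Gop i) J x| ≤ A * ((geomT i.D).len y * |i.cf|⁻¹) * Real.exp (-(delta3 (1 / 2) (2 * σ₁) * (geomT i.D).dist y y')) * B := by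
      have h' := h1 ν y' J B hBS x; rw [hx] at h'; exact h'
    rw [hlen1] at h
    calc |(DV ν i.cf ∘ₗ Gop i) J x| ≤ A * (kGeoG i).len y * Real.exp (-(delta3 (1 / 2) (2 * σ₁) * (geomT i.D).dist y y')) * B := h
      _ ≤ C * (kGeoG i).len y * Real.exp (-(δ₃ * (geomT i.D).dist y y')) * B := by
        gcongr
  · -- (2.136)₃  |(G∇*_νJ)(x)| ≤ C·(Lʲη)·e^{−δ₃d}·|J|  (the displayed input)
    show (⨆ ν : Fin (d + 1), supIn i y ((Gop i ∘ₗ DVa ν i.cf) J)) ≤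
      C * B6.pref4 ((kGeoG i).len y) 2 * Real.exp (-(δ₃ * (geomT i.D).dist y y')) * B
    rw [hp2]
    refine Real.iSup_le (fun ν => supIn_le i (by positivity) fun x hx => ?_) (by positivity)
    have h : |(Gop i ∘ₗ DVa ν i.cf) J x| ≤ A' * ((geomT i.D).len y * |i.cf|⁻¹) * Real.exp (-(δ * (geomT i.D).dist y y')) * B := by
      have h' := h2 ν y' J B hBS x; rw [hx] at h'; exact h'
    rw [hlen1] at h
    calc |(Gop i ∘ₗ DVa ν i.cf) J x| ≤ A' * (kGeoG i).len y * Real.exp (-(δ * (geomT i.D).dist y y')) * B := h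
      _ ≤ C * (kGeoG i).len y * Real.exp (-(δ₃ * (geomT i.D).dist y y')) * B := by
        gcongr
  · -- (2.136)₄  |(ΔGJ)(x)| ≤ C·e^{−δ₃d}·|J|
    show supIn i y ((LapV i.cf ∘ₗ Gop i) J) ≤ C * B6.pref4 ((kGeoG i).len y) 3 * Real.exp (-(δ₃ * (geomT i.D).dist y y')) * B
    rw [hp3, mul_one]
    refine supIn_le i (by positivity) fun x hx => ?_
    have h : |(LapV i.cf ∘ₗ Gop i) J x| ≤ A * Real.exp (-(delta3 (1 / 2) (2 * σ₁) * (geomT i.D).dist y y')) * B := by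
      have h' := hLap y' J B hBS x; rw [hx] at h'; exact h'
    calc |(LapV i.cf ∘ₗ Gop i) J x| ≤ A * Real.exp (-(delta3 (1 / 2) (2 * σ₁) * (geomT i.D).dist y y')) * B := h
      _ ≤ C * Real.exp (-(δ₃ * (geomT i.D).dist y y')) * B := by
        gcongr

/-! ## §3  Non-vacuity at `L = 5` -/

/-- **NON-VACUITY** (`L = 5`): for every census threshold `M₁`, every `k ≥ 2` and every band there is an index of the family with `M₁ ≤ M = L·M_h`
(`B6KLevelFamilyWitnessV1.kLevelFamily_nonvacuous_L5`: two top levels, `P′ = 2·5²`, `R = 2·5²`, `c_f = 1`).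
[cite: Balaban1984PropagatorsII, Prop. 2.6 p.247, (2.2) p.224] -/
theorem kLevelG_meets_hypotheses (d k : ℕ) (hd : 1 ≤ d + 1) (hL : Odd (4 + 1) ∧ 1 < 4 + 1) (hk : 2 ≤ k) (M₁ : ℝ)
    {b₀ b₁ : ℝ} (hb₀ : 0 < b₀) (hb₁ : b₀ ≤ b₁) :
    ∃ i : KIdx d 4 hd hL b₀ b₁, i.k = k ∧ (kGeoG i).Hyp21_22 ∧ M₁ ≤ (kGeoG i).M := by
  obtain ⟨m, K, Mh, R, a, P', hN, D, hk', w, hMha, hM8, hR2, hP5, -, hpl, hM, -, hw, hwb, -, -⟩ :=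
    B6KLevelFamilyWitnessV1.kLevelFamily_nonvacuous_L5 d k hd hL hk M₁ 0 hb₀ hb₁
  refine ⟨⟨m, K, Mh, k, R, a, P', hN, D, hk', hk, hMha, hM8, hR2, hP5, le_rfl, hpl, 1, one_ne_zero, w, hw, hwb⟩, rfl, trivial, ?_⟩
  show M₁ ≤ (((4 + 1 : ℕ) : ℝ)) * (Mh : ℝ)
  have hcast : (((4 + 1 : ℕ) : ℝ)) = ((4 : ℕ) : ℝ) + 1 := by push_cast; ring
  rw [hcast]; exact hM

end Literature.MathematicalPhysics.QuantumFieldTheory.Balaban1983to89.B6Prop26Census2136KLevelV1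

end
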